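import Summits.Ventures.QEC.Census.CertCheckBZ
import Summits.Ventures.QEC.Census.BZAssembly
import Summits.Ventures.QEC.Census.Bits
import HarnessLib

/-!
# Bridge lemmas for the Brouwer–Zimmermann branch of the CSS distance-certificate checker
# (plan/CERT-FORMAT.md v1.1 §5.3; census/search-1/BZ-CHECKER-SPEC.md §C3–C5 ⇒ the hypotheses of §L)

`Census/CertCheckBZ.lean` (qec-type-10) is the Bool replay of a `bz` certificate over binary numerals;
`Census/BZAssembly.lean` (qec-type-07) is the mathematics (`bz_block`, `bz_cover_of_blocks`, on top of
`Literature/InformationTheory/Coding/BrouwerZimmermannBound.lean` = lemma L5). This file proves, check by check, that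
the passing Bool checks discharge the hypotheses of those theorems:

* C5 cover: `coverOK k blocks` ⇒ every nonzero label vector lies in the span of some block's `W`
  (`exists_block_of_coverOK`, through `testBit_maskOf`, `mem_span_of_mem_subsetXors` and type-01's `toBits`);
* block-code containments: `rs Hstab ≤ span G_b` (`rowSpace_le_span_gbRows`: every `Hstab` row is a XOR of pivot
  rows by type-02's rank certificate) and `Σ w_i L_i ∈ span G_b` (`sum_smul_logVec_mem_span_gbRows`);
* C3 systematic: `systematicOK` ⇒ `G_i j (T_i j') = [j = j']` for the total column/row functions `colFun`/`rowFun`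
  (`hsys_of_systematicOK`), and the information positions are the bits of `maskOf T` (`infoPositions_colFun`);
* C3 bound: the checker's mask recount `bzBoundList` IS Grassl's relative-rank bound `bzBound T t` of the Literature
  file (`bzBoundList_eq_bzBound`; new positions `𝓘_i ∖ ⋃_{l<i} 𝓘_l` = bits of `T_i ⊕ (T_i ∧ U)`);
* C4 replay: a passing `scan` over the rows of `G_i` with leaf `bzLeaf` ⇒ every selection `a` with `1 ≤ |a| ≤ t_i`
  and `|Σ a_j G_i[j]| ≤ wmax` yields an allow-listed, hence STABILIZER, codeword (`henum_of_matrixOK`, through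
  `Census/CertBZWords.lean`: `rowSupp`, `wtGt`).

The assembly into `(c.code _).dZ = c.dZ` is `Census/CertCheckBZSound.lean`. No distance value is asserted here.
-/

namespace Summit.Ventures.QEC.Census

open Matrix Finset Literature.InformationTheory.QuantumCodes Literature.InformationTheory.Coding

/-! ## Masks and label spans (C5) -/

/-- Bits of `maskOf`: bit `q` is set iff `q` is listed. -/
theorem testBit_maskOf (T : List ℕ) (q : ℕ) : (maskOf T).testBit q = decide (q ∈ T) := by
  induction T with
  | nil => simp [maskOf]
  | cons a T ih =>
    rw [maskOf, Nat.testBit_or, ih, Nat.testBit_two_pow]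
    by_cases h : a = q
    · subst h; simp
    · have h' : ¬ q = a := fun e => h e.symm
      simp [h, h']

/-- The bit set of `maskOf T` is the set of listed positions (below `n`). -/
theorem mem_bitSet_maskOf {n : ℕ} (T : List ℕ) (x : Fin n) : x ∈ bitSet n (maskOf T) ↔ (x : ℕ) ∈ T := by
  rw [mem_bitSet, testBit_maskOf, decide_eq_true_eq]

/-- Every XOR-combination of the words of `W` is, as a vector, in the span of the words of `W`. -/
theorem mem_span_of_mem_subsetXors (k : ℕ) (W : List ℕ) {x : ℕ} (hx : x ∈ subsetXors W) :
    ofBits k x ∈ Submodule.span (ZMod 2) {v | ∃ w ∈ W, v = ofBits k w} := by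
  induction W generalizing x with
  | nil =>
    simp only [subsetXors, List.mem_singleton] at hx
    subst hx
    rw [ofBits_zero]
    exact Submodule.zero_mem _
  | cons w ws ih =>
    have hmono : Submodule.span (ZMod 2) {v | ∃ w' ∈ ws, v = ofBits k w'} ≤
        Submodule.span (ZMod 2) {v | ∃ w' ∈ w :: ws, v = ofBits k w'} :=
      Submodule.span_mono fun v ⟨w', hw', hv⟩ => ⟨w', List.mem_cons_of_mem _ hw', hv⟩
    simp only [subsetXors, List.mem_append, List.mem_map] at hx
    rcases hx with hx | ⟨y, hy, rfl⟩
    · exact hmono (ih hx)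
    · rw [ofBits_xor]
      refine Submodule.add_mem _ (hmono (ih hy)) (Submodule.subset_span ⟨w, ?_, rfl⟩)
      exact List.mem_cons_self

/-- The set of word-vectors of a list is the range of the indexed family. -/
theorem setOf_ofBits_mem_eq_range (k : ℕ) (W : List ℕ) :
    {v | ∃ w ∈ W, v = ofBits k w} = Set.range fun l : Fin W.length => ofBits k W[l] := by
  ext v
  constructor
  · rintro ⟨w, hw, rfl⟩
    obtain ⟨l, hl, rfl⟩ := List.getElem_of_mem hw
    exact ⟨⟨l, hl⟩, rfl⟩
  · rintro ⟨l, rfl⟩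
    exact ⟨W[l], List.getElem_mem l.2, rfl⟩

/-- Bits of the cover bitmap: bit `x` set ⇒ `x` is a XOR-combination of some block's `W`. -/
theorem exists_mem_subsetXors_of_testBit_coverMask (blocks : List BZBlock) {x : ℕ}
    (h : (coverMask blocks).testBit x = true) : ∃ b : Fin blocks.length, x ∈ subsetXors (blocks[b]).W := by
  induction blocks with
  | nil => simp [coverMask] at h
  | cons blk bs ih =>
    rw [coverMask, Nat.testBit_or, Bool.or_eq_true, testBit_maskOf, decide_eq_true_eq] at h
    rcases h with h | h
    · exact ⟨⟨0, by simp⟩, h⟩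
    · obtain ⟨⟨b, hb⟩, hx⟩ := ih h
      exact ⟨⟨b + 1, by simpa using hb⟩, hx⟩

/-- **C5 ⇒ cover**: if `coverOK k blocks` passes, every NONZERO label vector lies in the span of the label words of
some block (the `hcover` hypothesis of `bz_cover_of_blocks`). -/
theorem exists_block_of_coverOK {k : ℕ} {blocks : List BZBlock} (h : coverOK k blocks = true)
    (lam : Fin k → ZMod 2) (hlam : lam ≠ 0) :
    ∃ b : Fin blocks.length, lam ∈ Submodule.span (ZMod 2)
      (Set.range fun l : Fin (blocks[b]).W.length => ofBits k (blocks[b]).W[l]) := by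
  simp only [coverOK, List.all_eq_true, List.mem_range, Bool.or_eq_true, beq_iff_eq] at h
  -- the word of `lam`
  have hw : ofBits k (Summit.Ventures.QEC.toBits lam) = lam := Summit.Ventures.QEC.ofBits_toBits lam
  have hlt : Summit.Ventures.QEC.toBits lam < 2 ^ k := Summit.Ventures.QEC.toBits_lt lam
  have hne : Summit.Ventures.QEC.toBits lam ≠ 0 := by
    intro h0
    apply hlam
    rw [← hw, h0, ofBits_zero]
  rcases h _ hlt with h0 | hbit
  · exact absurd h0 hne
  · obtain ⟨b, hx⟩ := exists_mem_subsetXors_of_testBit_coverMask blocks hbit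
    refine ⟨b, ?_⟩
    rw [← hw, ← setOf_ofBits_mem_eq_range]
    exact mem_span_of_mem_subsetXors k _ hx

/-! ## Rows, spans and selections -/

/-- The row space of a row list is the span of its row vectors. -/
theorem rowSpace_rowMatrix_eq_span (n : ℕ) (G : List ℕ) :
    rowSpace (rowMatrix n G) = Submodule.span (ZMod 2) (Set.range fun j : Fin G.length => rowMatrix n G j) := by
  rw [rowSpace, range_vecMulLinear]
  rfl

/-- A linear combination of the rows of a row list is the vector–matrix product. -/
theorem sum_smul_rowMatrix_eq_vecMul (n : ℕ) (G : List ℕ) (a : Fin G.length → ZMod 2) :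
    ∑ j, a j • rowMatrix n G j = a ᵥ* rowMatrix n G := by
  funext q
  simp only [Finset.sum_apply, Pi.smul_apply, smul_eq_mul, vecMul, dotProduct]

/-- From type-02's rank certificate: every row of `H` is in the span of the pivot rows it names (pivot rows
trivially, the others by their checked decomposition). -/
theorem row_mem_span_pivotRows {n : ℕ} {H : List ℕ} {rc : RankCert} (h : rc.check n H = true)
    (i : Fin H.length) :
    rowMatrix n H i ∈ rowSpace (rowMatrix n (rc.pivots.map fun p => H.getD p 0)) := by
  simp only [RankCert.check, RankCert.pivotsOK, Bool.and_eq_true, List.all_eq_true, List.mem_range,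
    decide_eq_true_eq] at h
  obtain ⟨⟨⟨⟨-, -⟩, hlt⟩, -⟩, hrow⟩ := h
  have hrowi : rowMatrix n H i = ofBits n (H.getD i 0) := by
    rw [List.getD_eq_getElem?_getD, List.getElem?_eq_getElem i.2, Option.getD_some]
    rfl
  have hh := hrow i i.2
  simp only [RankCert.rowOK, Bool.or_eq_true] at hh
  rcases hh with hmem | hdep
  · -- a pivot row: it is one of the rows of the pivot-row matrix
    obtain ⟨a, ha, hpa⟩ := List.getElem_of_mem (List.mem_of_elem_eq_true hmem)
    have ha' : a < (rc.pivots.map fun p => H.getD p 0).length := by simpa using ha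
    refine mem_rowSpace_of_vecMul_eq (Pi.single ⟨a, ha'⟩ 1) ?_
    rw [Matrix.single_one_vecMul, hrowi]
    funext q
    simp only [Matrix.row, rowMatrix, Fin.getElem_fin, List.getElem_map, hpa]
  · split at hdep
    · rename_i sel _
      rw [beq_iff_eq] at hdep
      rw [hrowi, ← hdep]
      exact ofBits_xorRows_mem_rowSpace n _ sel
    · exact absurd hdep Bool.false_ne_true

/-- The stabilizer row space lies in the span of the block rows `G_b` (whose first rows ARE the pivot rows). -/
theorem rowSpace_le_span_gbRows {n : ℕ} {Hstab : List ℕ} {rcS : RankCert} (h : rcS.check n Hstab = true)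
    (L : List ℕ) (blk : BZBlock) :
    rowSpace (rowMatrix n Hstab) ≤ rowSpace (rowMatrix n (gbRows Hstab rcS L blk)) := by
  -- rows of Hstab ↦ span of pivot rows ↦ span of G_b rows (a prefix)
  have h1 : rowSpace (rowMatrix n Hstab) ≤ rowSpace (rowMatrix n (rcS.pivots.map fun p => Hstab.getD p 0)) := by
    rw [rowSpace_rowMatrix_eq_span n Hstab]
    exact Submodule.span_le.2 (by rintro _ ⟨i, rfl⟩; exact row_mem_span_pivotRows h i)
  refine h1.trans ?_
  rw [rowSpace_rowMatrix_eq_span, Submodule.span_le]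
  rintro _ ⟨j, rfl⟩
  have hj : (j : ℕ) < (gbRows Hstab rcS L blk).length := by
    have := j.2
    simp only [List.length_map, gbRows, List.length_append] at this ⊢
    omega
  refine mem_rowSpace_of_vecMul_eq (Pi.single ⟨j, hj⟩ 1) ?_
  rw [Matrix.single_one_vecMul]
  funext q
  simp only [Matrix.row, rowMatrix, Fin.getElem_fin, gbRows]
  rw [List.getElem_append_left (by simpa using j.2)]

/-- The block's logical combinations `Σ_i w_i L_i` (for `w ∈ W`) lie in the span of the block rows `G_b`. -/
theorem sum_smul_logVec_mem_span_gbRows (n : ℕ) (Hstab : List ℕ) (rcS : RankCert) (L : List ℕ) (blk : BZBlock)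
    (l : Fin blk.W.length) :
    ∑ i, ofBits L.length blk.W[l] i • logVec n L i ∈ rowSpace (rowMatrix n (gbRows Hstab rcS L blk)) := by
  have h1 : ∑ i, ofBits L.length blk.W[l] i • logVec n L i = ofBits n (xorSel L blk.W[l]) := by
    rw [ofBits_xorSel_eq_vecMul, ← sum_smul_rowMatrix_eq_vecMul]
    rfl
  rw [h1]
  have hj : rcS.pivots.length + (l : ℕ) < (gbRows Hstab rcS L blk).length := by
    simp [gbRows]
  refine mem_rowSpace_of_vecMul_eq (Pi.single ⟨_, hj⟩ 1) ?_
  rw [Matrix.single_one_vecMul]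
  funext q
  simp only [Matrix.row, rowMatrix, Fin.getElem_fin, gbRows]
  rw [List.getElem_append_right (by simp)]
  simp

/-! ## C3: systematic matrices and the relative-rank bound -/

section Matrices

variable {n : ℕ}

/-- The column function of an information-set list (total: reduced `mod n`; equal to the entry when it is `< n`). -/
def colFun (hn : 0 < n) (T : List ℕ) (kb : ℕ) (j : Fin kb) : Fin n := ⟨T.getD j 0 % n, Nat.mod_lt _ hn⟩

/-- The row function of a row list (total: `0` past the end). -/
def rowFun (n : ℕ) (G : List ℕ) (kb : ℕ) (j : Fin kb) : Fin n → ZMod 2 := ofBits n (G.getD j 0)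

/-- `systematicOK` ⇒ the abstract systematic property `G j (T j') = [j = j']` (hypothesis `hsys` of `bz_block`). -/
theorem hsys_of_systematicOK (hn : 0 < n) {G T : List ℕ} (h : systematicOK n G T = true) {kb : ℕ}
    (hkb : T.length = kb) (j j' : Fin kb) :
    rowFun n G kb j (colFun hn T kb j') = if j = j' then 1 else 0 := by
  simp only [systematicOK, Bool.and_eq_true, List.all_eq_true, List.mem_range, beq_iff_eq,
    decide_eq_true_eq] at h
  obtain ⟨⟨-, hlt⟩, hsys⟩ := h
  have hj' : (j' : ℕ) < T.length := hkb ▸ j'.2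
  have hTj : T.getD (j' : ℕ) 0 < n := by
    rw [List.getD_eq_getElem?_getD, List.getElem?_eq_getElem hj', Option.getD_some]
    exact hlt _ (List.getElem_mem hj')
  have h1 := hsys j (hkb ▸ j.2) j' hj'
  simp only [rowFun, colFun, ofBits, Nat.mod_eq_of_lt hTj, h1, decide_eq_true_eq, Fin.ext_iff]

/-- The column function is injective on a systematic matrix (distinct pivots). -/
theorem colFun_injective (hn : 0 < n) {G T : List ℕ} (h : systematicOK n G T = true) {kb : ℕ}
    (hkb : T.length = kb) : Function.Injective (colFun hn T kb) :=
  injective_of_systematic (F := ZMod 2) (G := rowFun n G kb) fun j j' => hsys_of_systematicOK hn h hkb j j'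

/-- The information positions of a column list (entries `< n`, length `kb`) are the bits of `maskOf T`. -/
theorem infoPositions_colFun (hn : 0 < n) {T : List ℕ} (hlt : ∀ q ∈ T, q < n) {kb : ℕ}
    (hkb : T.length = kb) : infoPositions (colFun hn T kb) = bitSet n (maskOf T) := by
  ext x
  rw [infoPositions, mem_image, mem_bitSet_maskOf]
  constructor
  · rintro ⟨j, -, rfl⟩
    have hj : (j : ℕ) < T.length := hkb ▸ j.2
    have : T.getD (j : ℕ) 0 = T[(j : ℕ)] := by
      rw [List.getD_eq_getElem?_getD, List.getElem?_eq_getElem hj, Option.getD_some]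
    simp only [colFun, this, Nat.mod_eq_of_lt (hlt _ (List.getElem_mem hj))]
    exact List.getElem_mem hj
  · intro hx
    obtain ⟨j, hj, hjx⟩ := List.getElem_of_mem hx
    refine ⟨⟨j, hkb ▸ hj⟩, mem_univ _, Fin.ext ?_⟩
    have : T.getD j 0 = T[j] := by
      rw [List.getD_eq_getElem?_getD, List.getElem?_eq_getElem hj, Option.getD_some]
    simp only [colFun, this, hjx, Nat.mod_eq_of_lt x.2]

/-- The mask recount, generalized over the accumulated mask `U`: each matrix contributes
`t + 1 − (kb − |𝓘_i ∖ (bits U ∪ ⋃_{l<i} 𝓘_l)|)`. -/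
theorem bzBoundList_eq_sum (n kb : ℕ) (mats : List BZMatrix) (U : ℕ) :
    bzBoundList n kb mats U = ∑ i : Fin mats.length, ((mats[i]).t + 1 - (kb -
      (bitSet n (maskOf (mats[i]).T) \ (bitSet n U ∪
        (univ.filter fun l : Fin mats.length => l < i).biUnion fun l => bitSet n (maskOf (mats[l]).T))).card)) := by
  induction mats generalizing U with
  | nil => simp [bzBoundList]
  | cons mt mts ih =>
    rw [bzBoundList, ih (U ||| maskOf mt.T)]
    simp only [List.length_cons, Fin.sum_univ_succ, Fin.getElem_fin, Fin.val_zero, List.getElem_cons_zero,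
      Fin.val_succ, List.getElem_cons_succ]
    congr 1
    · -- the head term: no earlier matrix
      have hfilter : (univ.filter fun x : Fin (mts.length + 1) => x < 0) = ∅ := by
        ext l; simp
      rw [hfilter, Finset.biUnion_empty, Finset.union_empty, ← bitSet_xor_and, card_bitSet]
    · refine Finset.sum_congr rfl fun i _ => ?_
      -- bits (U ||| M) ∪ ⋃_{l<i} 𝓘(mts[l]) = bits U ∪ ⋃_{l < i.succ} 𝓘((mt::mts)[l])
      have hset : (bitSet n (U ||| maskOf mt.T) ∪
            (univ.filter fun l : Fin mts.length => l < i).biUnion fun l => bitSet n (maskOf (mts[(l : ℕ)]).T)) =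
          bitSet n U ∪ (univ.filter fun x : Fin (mts.length + 1) => x < i.succ).biUnion
            fun l => bitSet n (maskOf ((mt :: mts)[(l : ℕ)]).T) := by
        ext x
        simp only [bitSet_or, Finset.mem_union, Finset.mem_biUnion, Finset.mem_filter, Finset.mem_univ, true_and]
        constructor
        · rintro ((hU | hM) | ⟨l, hl, hx⟩)
          · exact Or.inl hU
          · exact Or.inr ⟨0, Fin.succ_pos i, by simpa using hM⟩
          · exact Or.inr ⟨l.succ, Fin.succ_lt_succ_iff.2 hl, by simpa using hx⟩
        · rintro (hU | ⟨l, hl, hx⟩)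
          · exact Or.inl (Or.inl hU)
          · cases l using Fin.cases with
            | zero => exact Or.inl (Or.inr (by simpa using hx))
            | succ l' => exact Or.inr ⟨l', Fin.succ_lt_succ_iff.1 hl, by simpa using hx⟩
      simp only [hset]

/-- **C3 ⇒ the Brouwer–Zimmermann bound**: for a block whose matrices have column lists of length `kb` with
entries `< n`, the checker's recount `bzBoundList n kb mats 0` equals Grassl's `bzBound T t` of the Literature file. -/
theorem bzBoundList_eq_bzBound (hn : 0 < n) {kb : ℕ} {mats : List BZMatrix}
    (hlt : ∀ (i : Fin mats.length) (q : ℕ), q ∈ (mats[i]).T → q < n)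
    (hkb : ∀ i : Fin mats.length, (mats[i]).T.length = kb) :
    bzBoundList n kb mats 0 =
      bzBound (fun i : Fin mats.length => colFun hn (mats[i]).T kb) fun i => (mats[i]).t := by
  rw [bzBoundList_eq_sum, bzBound]
  refine Finset.sum_congr rfl fun i _ => ?_
  have hI : ∀ l : Fin mats.length, infoPositions (colFun hn (mats[l]).T kb) = bitSet n (maskOf (mats[l]).T) :=
    fun l => infoPositions_colFun hn (hlt l) (hkb l)
  simp only [relRank, newPositions, hI, bitSet_zero, Finset.empty_union]

end Matrices

/-! ## C4: the replay of one matrix -/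

section Replay

variable {n : ℕ}

/-- The rows of `G_i = A_i · G_b` lie in the row space of `G_b` (hypothesis `hG` of `bz_block`). -/
theorem rowFun_giRows_mem (Gb : List ℕ) (mt : BZMatrix) (kb : ℕ) (j : Fin kb) :
    rowFun n (giRows Gb mt) kb j ∈ rowSpace (rowMatrix n Gb) := by
  unfold rowFun giRows
  by_cases hj : (j : ℕ) < mt.A.length
  · have : (mt.A.map (xorSel Gb)).getD (j : ℕ) 0 = xorSel Gb mt.A[(j : ℕ)] := by
      rw [List.getD_eq_getElem?_getD, List.getElem?_map, List.getElem?_eq_getElem hj]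
      rfl
    rw [this]
    exact ofBits_xorSel_mem_rowSpace n Gb _
  · have : (mt.A.map (xorSel Gb)).getD (j : ℕ) 0 = 0 := by
      rw [List.getD_eq_getElem?_getD, List.getElem?_map, List.getElem?_eq_none (not_lt.mp hj)]
      rfl
    rw [this, ofBits_zero]
    exact Submodule.zero_mem _

/-- **C4 ⇒ the enumeration verdict** (hypothesis `henum` of `bz_block`): if the allow-list decomposes over the
stabilizer rows and `matrixOK` passes for `G_i`, then every selection `a` with `1 ≤ |a| ≤ t_i` whose codeword
`Σ a_j G_i[j]` has weight `≤ wmax` gives a STABILIZER codeword — the scan reached the support list of `a`, the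
selection word is nonzero, the fast weight test cannot have fired, so the codeword is allow-listed. -/
theorem henum_of_matrixOK {wmax : ℕ} {found : List (ℕ × List ℕ)} {Hstab Gb : List ℕ} {mt : BZMatrix}
    (hfound : foundOK Hstab found = true) (hmt : matrixOK n wmax (found.map Prod.fst) Gb mt = true)
    {kb : ℕ} (hk : (giRows Gb mt).length = kb) (a : Fin kb → ZMod 2) (ha1 : 1 ≤ hammingNorm a)
    (hat : hammingNorm a ≤ mt.t) (haw : hammingNorm (∑ j, a j • rowFun n (giRows Gb mt) kb j) ≤ wmax) :
    (∑ j, a j • rowFun n (giRows Gb mt) kb j) ∈ rowSpace (rowMatrix n Hstab) := by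
  subst hk
  simp only [matrixOK, Bool.and_eq_true, List.all_eq_true, decide_eq_true_eq] at hmt
  obtain ⟨⟨-, hlt⟩, hscan⟩ := hmt
  -- the selection's support list is reached by the scan
  have hreach := reaches_of_scan hscan (rowSupp (giRows Gb mt) a) (rowSupp_sublist _ a)
    (by rw [length_rowSupp]; exact hat)
  rw [Nat.zero_xor, Nat.zero_xor, bzLeaf] at hreach
  -- the codeword of the support list is the combination
  have hsum : ∑ j, a j • rowFun n (giRows Gb mt) (giRows Gb mt).length j =
      ofBits n (xorSnd (rowSupp (giRows Gb mt) a)) := by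
    rw [ofBits_xorSnd_rowSupp, ← sum_smul_rowMatrix_eq_vecMul]
    refine Finset.sum_congr rfl fun j _ => ?_
    congr 1
    funext q
    simp only [rowFun, rowMatrix, Fin.getElem_fin, List.getD_eq_getElem?_getD, List.getElem?_eq_getElem j.2,
      Option.getD_some]
  -- the selection word is nonzero
  have hu : xorFst (rowSupp (giRows Gb mt) a) ≠ 0 := by
    intro h0
    have ha := ofBits_xorFst_rowSupp (giRows Gb mt) a
    rw [h0, ofBits_zero] at ha
    have hpos : 0 < hammingNorm a := ha1
    rw [hammingNorm_pos_iff] at hpos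
    exact hpos ha.symm
  -- the codeword is a word below 2^n
  have hclt : xorSnd (rowSupp (giRows Gb mt) a) < 2 ^ n := by
    refine xorList_lt n _ fun x hx => ?_
    simp only [rowSupp, List.map_map, List.mem_map, Function.comp_apply] at hx
    obtain ⟨j, hj, rfl⟩ := hx
    have hjl := lt_of_mem_suppIdx _ a hj
    rw [List.getD_eq_getElem?_getD, List.getElem?_eq_getElem hjl, Option.getD_some]
    exact hlt _ (List.getElem_mem hjl)
  simp only [Bool.or_eq_true, beq_iff_eq] at hreach
  rcases hreach with (h0 | hwt) | hmem
  · exact absurd h0 hu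
  · have h1 := lt_popc_of_wtGt n wmax _ hclt hwt
    rw [← hammingNorm_ofBits, ← hsum] at h1
    omega
  · obtain ⟨e, he, hex⟩ : ∃ e ∈ found, e.1 = xorSnd (rowSupp (giRows Gb mt) a) := by
      simpa [List.mem_map] using List.mem_of_elem_eq_true hmem
    simp only [foundOK, List.all_eq_true, beq_iff_eq] at hfound
    rw [hsum, ← hex, ← hfound e he]
    exact ofBits_xorRows_mem_rowSpace n Hstab e.2

end Replay

end Summit.Ventures.QEC.Census
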